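import Mathlib.RingTheory.Trace.Basic
import Mathlib.LinearAlgebra.BilinearForm.Properties
import HarnessLib

/-!
# Descent of balanced bilinear forms along the trace: `B = Tr_{K/k} ∘ B_K`

Topic `Literature/LinearAlgebra`.  Theorems only (no definition, no named fact), Mathlib vocabulary (`Algebra.trace`,
`Algebra.traceForm`, `LinearMap.BilinForm`).  For a finite separable field extension `K/k` and a `K`-vector space `V`, a
`k`-bilinear form `B` on `V` which is `K`-BALANCED (`B(a x, y) = B(x, a y)` for `a ∈ K`) is the trace of a unique `K`-bilinear
form: `B(a x, y) = Tr_{K/k}(a · B_K(x, y))`; symmetry/antisymmetry, non-degeneracy and adjoint pairs of `K`-linear maps transfer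
between `B` and `B_K`.  This is the standard device behind the Lefschetz groups of abelian varieties whose endomorphism algebra
has centre a totally real field `F ≠ ℚ` (Milne 1999 §2: the Riemann form `ψ` is `F`-balanced, `ψ = Tr_{F/ℚ} ∘ ψ_F`, and the
centraliser of `End⁰` in `Sp(H¹, ψ)` is a restriction of scalars `Res_{F/ℚ}` of a unitary/symplectic/orthogonal group of `ψ_F`);
written for the cell `pub-hodgecm2` (COR-CM), seat `b27`, count-neutral Mumford–Tate-rank lane (Lefschetz bounds over a
general totally real centre).

* **`exists_forall_trace_mul_eq`** — existence of `B_K` with `Tr(a · B_K(x, y)) = B(a x, y)` for all `a ∈ K` (the trace form of a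
  finite separable extension is non-degenerate, Mathlib's `traceForm_nondegenerate`, so `a ↦ B(a x, y)` is `Tr(a · c)` for a unique `c`).
* `eq_of_forall_trace_mul_eq`, **`bilinForm_unique_of_trace`** — uniqueness.
* `apply_eq_trace`, `isAdjointPair_iff_of_trace`, `flip_eq_neg_iff_of_trace`, `separatingLeft_of_trace` — `B = Tr ∘ B_K`; a pair of
  `K`-linear maps is `B`-adjoint iff `B_K`-adjoint; `B` is antisymmetric iff `B_K` is; `B` non-degenerate ⟹ `B_K` non-degenerate.

## References
* [Milne1999LefschetzClasses] J. S. Milne, *Lefschetz classes on abelian varieties*, Duke Math. J. 96 (1999), §2 (the form `ψ`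
  "arises from" an `F`-bilinear form by the trace; the groups `S(A)` as restrictions of scalars).
* [Scharlau1985HermitianForms] W. Scharlau, *Quadratic and Hermitian Forms*, Grundlehren 270 (1985), Ch. 2 §5 (transfer `Tr_* : W(K) → W(k)`,
  Lemma 5.8: the trace of a regular form is regular).
-/

namespace Literature.LinearAlgebra.QuadraticForm

namespace TraceFormDescent

open Module

variable {k K : Type*} [Field k] [Field K] [Algebra k K] [FiniteDimensional k K] [Algebra.IsSeparable k K]
  {V : Type*} [AddCommGroup V] [Module K V] [Module k V] [IsScalarTower k K V]

/-- Non-degeneracy of the trace form: `Tr(a c) = Tr(a c')` for all `a` forces `c = c'`. [cite: Scharlau1985HermitianForms, Ch. 2 §5 Lemma 5.8] -/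
theorem eq_of_forall_trace_mul_eq {c c' : K} (h : ∀ a : K, Algebra.trace k K (a * c) = Algebra.trace k K (a * c')) : c = c' := by
  have hnd := traceForm_nondegenerate (K := k) (L := K)
  rw [← sub_eq_zero]
  refine hnd.1 (c - c') fun a => ?_
  rw [Algebra.traceForm_apply, sub_mul, map_sub, mul_comm c a, mul_comm c' a, h a, sub_self]

/-- **Existence of the descended form**: for a `K`-balanced `k`-bilinear form `B` on a `K`-vector space (`K/k` finite separable)
there is a `K`-bilinear form `B_K` with `Tr_{K/k}(a · B_K(x, y)) = B(a x, y)` for all `a ∈ K`, `x, y ∈ V` — for fixed `x, y` the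
functional `a ↦ B(a x, y)` is represented through the non-degenerate trace form. [cite: Milne1999LefschetzClasses, §2]
[cite: Scharlau1985HermitianForms, Ch. 2 §5] -/
theorem exists_forall_trace_mul_eq (B : LinearMap.BilinForm k V) (hbal : ∀ (a : K) (x y : V), B (a • x) y = B x (a • y)) :
    ∃ B' : LinearMap.BilinForm K V, ∀ (a : K) (x y : V), Algebra.trace k K (a * B' x y) = B (a • x) y := by
  classical
  have hnd := traceForm_nondegenerate (K := k) (L := K)
  -- the coefficient `c x y ∈ K` with `Tr(c a) = B(a x, y)`
  let φ : V → V → Module.Dual k K := fun x y => (B.flip y) ∘ₗ (LinearMap.toSpanSingleton K V x).restrictScalars k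
  have hφ : ∀ x y a, φ x y a = B (a • x) y := fun x y a => by
    change B ((LinearMap.toSpanSingleton K V x) a) y = _
    rw [LinearMap.toSpanSingleton_apply]
  let c : V → V → K := fun x y => ((Algebra.traceForm k K).toDual hnd).symm (φ x y)
  have hc : ∀ a x y, Algebra.trace k K (a * c x y) = B (a • x) y := fun a x y => by
    rw [mul_comm, ← Algebra.traceForm_apply, LinearMap.BilinForm.apply_toDual_symm_apply, hφ]
  -- bilinearity, by uniqueness
  have hadd₁ : ∀ x x' y, c (x + x') y = c x y + c x' y := fun x x' y =>
    eq_of_forall_trace_mul_eq (k := k) fun a => by rw [mul_add, map_add, hc, hc, hc, smul_add, map_add, LinearMap.add_apply]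
  have hsmul₁ : ∀ (s : K) x y, c (s • x) y = s * c x y := fun s x y =>
    eq_of_forall_trace_mul_eq (k := k) fun a => by rw [hc, ← mul_assoc, hc, mul_smul]
  have hadd₂ : ∀ x y y', c x (y + y') = c x y + c x y' := fun x y y' =>
    eq_of_forall_trace_mul_eq (k := k) fun a => by rw [mul_add, map_add, hc, hc, hc, map_add]
  have hsmul₂ : ∀ (s : K) x y, c x (s • y) = s * c x y := fun s x y =>
    eq_of_forall_trace_mul_eq (k := k) fun a => by rw [hc, ← hbal, smul_smul, mul_comm s a, ← mul_assoc, hc]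
  exact ⟨LinearMap.mk₂ K c hadd₁ (fun s x y => by rw [smul_eq_mul]; exact hsmul₁ s x y) hadd₂
    (fun s x y => by rw [smul_eq_mul]; exact hsmul₂ s x y), fun a x y => by rw [LinearMap.mk₂_apply]; exact hc a x y⟩

variable {B : LinearMap.BilinForm k V} {B' : LinearMap.BilinForm K V}

omit [FiniteDimensional k K] [Algebra.IsSeparable k K] [IsScalarTower k K V] in
/-- `B = Tr ∘ B_K` (the case `a = 1` of the defining property). [cite: Milne1999LefschetzClasses, §2] -/
theorem apply_eq_trace (hB' : ∀ (a : K) (x y : V), Algebra.trace k K (a * B' x y) = B (a • x) y) (x y : V) :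
    B x y = Algebra.trace k K (B' x y) := by
  rw [← one_mul (B' x y), hB', one_smul]

omit [IsScalarTower k K V] in
/-- **Uniqueness of the descended form.** [cite: Scharlau1985HermitianForms, Ch. 2 §5 Lemma 5.8] -/
theorem bilinForm_unique_of_trace {B'' : LinearMap.BilinForm K V}
    (hB' : ∀ (a : K) (x y : V), Algebra.trace k K (a * B' x y) = B (a • x) y)
    (hB'' : ∀ (a : K) (x y : V), Algebra.trace k K (a * B'' x y) = B (a • x) y) : B'' = B' :=
  LinearMap.ext fun x => LinearMap.ext fun y => eq_of_forall_trace_mul_eq (k := k) fun a => by rw [hB', hB'']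

omit [IsScalarTower k K V] in
/-- **Adjoint pairs transfer**: `K`-linear maps `T, S` satisfy `B(T x, y) = B(x, S y)` iff `B_K(T x, y) = B_K(x, S y)`.
[cite: Milne1999LefschetzClasses, §2] -/
theorem isAdjointPair_iff_of_trace (hB' : ∀ (a : K) (x y : V), Algebra.trace k K (a * B' x y) = B (a • x) y)
    (T S : V →ₗ[K] V) : (∀ x y, B (T x) y = B x (S y)) ↔ ∀ x y, B' (T x) y = B' x (S y) := by
  constructor
  · intro h x y
    refine eq_of_forall_trace_mul_eq (k := k) fun a => ?_
    rw [hB', hB', ← map_smul, h]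
  · intro h x y
    rw [apply_eq_trace hB', apply_eq_trace hB', h]

omit [IsScalarTower k K V] in
/-- **Antisymmetry transfers**: `B(y, x) = -B(x, y)` for all `x, y` iff `B_K(y, x) = -B_K(x, y)` for all `x, y`.
[cite: Scharlau1985HermitianForms, Ch. 2 §5] -/
theorem flip_eq_neg_iff_of_trace (hB' : ∀ (a : K) (x y : V), Algebra.trace k K (a * B' x y) = B (a • x) y)
    (hbal : ∀ (a : K) (x y : V), B (a • x) y = B x (a • y)) :
    (∀ x y, B y x = -B x y) ↔ ∀ x y, B' y x = -B' x y := by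
  constructor
  · intro h x y
    refine eq_of_forall_trace_mul_eq (k := k) fun a => ?_
    rw [hB', mul_neg, map_neg, hB', hbal, h]
  · intro h x y
    rw [apply_eq_trace hB', apply_eq_trace hB', h, map_neg]

omit [FiniteDimensional k K] [Algebra.IsSeparable k K] [IsScalarTower k K V] in
/-- **Non-degeneracy transfers**: if `B(x, ·) = 0` forces `x = 0`, then so does `B_K(x, ·) = 0`.
[cite: Scharlau1985HermitianForms, Ch. 2 §5 Lemma 5.8] -/
theorem separatingLeft_of_trace (hB' : ∀ (a : K) (x y : V), Algebra.trace k K (a * B' x y) = B (a • x) y)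
    (hB : ∀ x : V, (∀ y, B x y = 0) → x = 0) : ∀ x : V, (∀ y, B' x y = 0) → x = 0 :=
  fun x hx => hB x fun y => by rw [apply_eq_trace hB', hx y, map_zero]

end TraceFormDescent

end Literature.LinearAlgebra.QuadraticForm
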